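import Summits.CriticalPhenomena.PercolationContinuityZ3.Theorems.PercAnnulusCrossingSetToSetBridge
import Summits.CriticalPhenomena.PercolationContinuityZ3.Theorems.SoloInformedLinkedEvents
import HarnessLib

/-!
# (A2)□ gives one-arm quasi-multiplicativity over ALL pairs of scales — lane RSW3, lead seat gen 3

builds on p205010 (kernel theorem, internal audit signed; external expert review pending)

Cell `prim-rsw3` (post-continuity programme, LANE 3), lead seat (gen 3).  Helper file (`--supports`); no definitions,
no sorries; does not use p205010.

The lane's defs file types two strengths of (S2): `OneArmDoubling(At)` ⇔ quasi-multiplicativity at BOUNDED ratio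
(`PercAnnulusCrossingOneArmQuasiMultIffDoubling.lean`, `…BoundedRatio.lean`), and `Crossing.OneArmQuasiMultAt d p c` —
`c · π_p(n) · P_p(Λ(n) ↔ ∂ⁱⁿΛ(N) in Λ(N)) ≤ π_p(N)` for ALL `1 ≤ n ≤ N`, uniformly in the ratio `N/n` (Kesten-1987-type
quasi-multiplicativity; `OneArmQuasiMultAt ⇒ OneArmDoublingAt`, not conversely).  Seat p1 (gen 2) derived doubling from
Basu–Sapozhnikov's (A2) in box form; here the ALL-SCALES statement:

* `oneArmQuasiMultAt_of_setToSetQuasiMultAt` — **`SetToSetQuasiMultAt d p_c ϰ` (`d ≥ 2`, `ϰ > 0`) ⇒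
  `∃ c > 0, OneArmQuasiMultAt d p_c c`**, with `c = min(c₄, ϰ·c₀/(2d))` (`c₄` the ratio-4 doubling constant of
  `oneArmDoubling_four_of_setToSetQuasiMultAt`, `c₀ ≤ π_{p_c}(1)` the a-priori floor).  Far scales `N ≥ 2n+3`: p1's
  `oneArmProb_quasiMult_of_setToSetQM` at `m = ⌈n/2⌉` (`n ≤ 2m ≤ n+1 < N/2`), `π(2m) ≥ π(n+1) ≥ π(n)·π(1)/(2d)`
  (monotonicity, supermultiplicativity `RSW3.oneArmProb_mul_le`) and `P(Λ(n) ↔ ∂ⁱⁿΛ(N)) ≤ P(Λ(2m) ↔ ∂ⁱⁿΛ(N))`; near scales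
  `N ≤ 2n+2 ≤ 4n`: `π(N) ≥ π(4n) ≥ c₄·π(n)`.
* `oneArmQuasiMultAt_of_setToSetQuasiMult` — at `p_c(ℤ³)`: `SetToSetQuasiMult → ∃ c > 0, OneArmQuasiMultAt 3 p_c c`.

So the single open input of the printed IIC construction for `ℤ³` contains the lane's STRONGEST typed (S2) statement
(quasi-multiplicativity uniform in the aspect ratio), not only doubling.  Census face (non-rigorous, CENSUS-QM §8–§9): the
gluing constant `c*(x) = π(xm)/(π(m)·P(Λ(m) ↔ ∂ⁱⁿΛ(xm)))` reads `0.52/0.40/0.35/0.34` at `x = 4/8/16/32`, flat in `m` —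
consistent with a positive infimum over all ratios.

References: D. Basu, A. Sapozhnikov, ECP 22 (2017) no. 26, §1 (A2); H. Kesten, *Percolation Theory for Mathematicians*
(1982), Thm. 5.1; H. Kesten, Probab. Theory Related Fields 73 (1986) (quasi-multiplicativity of arm events in the plane).
-/

noncomputable section

namespace Summit.CriticalPhenomena.PercolationContinuityZ3.Theorems.Crossing

open MeasureTheory Literature.Probability.Percolation Literature.Probability.LatticeModels
open Literature.Probability.Percolation.DCT16
open Summit.CriticalPhenomena.PercolationContinuityZ3.Theorems.SurfaceTension

variable {d : ℕ}

/-- **(A2)□ at `p_c(ℤ^d)` ⇒ one-arm quasi-multiplicativity over ALL scale pairs** (`d ≥ 2`): if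
`SetToSetQuasiMultAt d p_c ϰ` with `ϰ > 0` then for some `c > 0` and all `1 ≤ n ≤ N`,
`c · π_{p_c}(n) · P_{p_c}(Λ(n) ↔ ∂ⁱⁿΛ(N) in Λ(N)) ≤ π_{p_c}(N)`.
[cite: BasuSapozhnikov2017ECP, §1 assumption (A2)] [cite: Kesten1982, Thm. 5.1] -/
theorem oneArmQuasiMultAt_of_setToSetQuasiMultAt (hd : 2 ≤ d) {ϰ : ℝ} (hϰ : 0 < ϰ)
    (h : SetToSetQuasiMultAt d (criticalProbI d) ϰ) :
    ∃ c : ℝ, 0 < c ∧ OneArmQuasiMultAt d (criticalProbI d) c := by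
  obtain ⟨c₄, hc₄, hfour⟩ := oneArmDoubling_four_of_setToSetQuasiMultAt hd hϰ h
  obtain ⟨c₀, hc₀, hfloor⟩ := exists_oneArmProb_criticalProbI_lower_half hd
  have hd0 : 0 < d := by omega
  have hdR : (0 : ℝ) < d := by exact_mod_cast hd0
  set μ := bondPercolation (zdGraph d) (criticalProbI d) with hμ
  have hπ1 : c₀ ≤ oneArmProb d (criticalProbI d) 1 := by
    have h1 := hfloor 1 le_rfl
    rwa [Nat.cast_one, Real.one_rpow, div_one] at h1
  -- p1's far-scale quasi-multiplicativity, in the bracketing of `SetToSetQuasiMultAt`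
  have hqm : ∀ m N : ℕ, 1 ≤ m → 4 * m < N →
      ϰ * oneArmProb d (criticalProbI d) (2 * m) * μ.real (boxCrossing d (2 * m) N) ≤
        oneArmProb d (criticalProbI d) N :=
    fun m N hm hN => oneArmProb_quasiMult_of_setToSetQM (criticalProbI d)
      (fun m hm Z hZ X hX Y hY => by rw [mul_assoc]; exact h m hm Z hZ X hX Y hY) hm hN
  refine ⟨min c₄ (ϰ * (c₀ / (2 * d))), lt_min hc₄ (by positivity), fun n N hn hnN => ?_⟩
  have hπn0 : 0 ≤ oneArmProb d (criticalProbI d) n := measureReal_nonneg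
  have hbc0 : 0 ≤ μ.real (boxCrossing d n N) := measureReal_nonneg
  have hbc1 : μ.real (boxCrossing d n N) ≤ 1 := measureReal_le_one
  have hmin0 : 0 ≤ min c₄ (ϰ * (c₀ / (2 * d))) := (lt_min hc₄ (by positivity)).le
  by_cases hfar : 2 * n + 3 ≤ N
  · -- far scales: `m = ⌈n/2⌉`, `n ≤ 2m ≤ n+1`, `4m < N`
    set m : ℕ := (n + 1) / 2 with hm
    have hm1 : 1 ≤ m := by omega
    have hn2m : n ≤ 2 * m := by omega
    have h2mn : 2 * m ≤ n + 1 := by omega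
    have h4m : 4 * m < N := by omega
    have hstep := hqm m N hm1 h4m
    -- `π(2m) ≥ π(n+1) ≥ π(n)·c₀/(2d)`
    have hanti : oneArmProb d (criticalProbI d) (n + 1) ≤ oneArmProb d (criticalProbI d) (2 * m) :=
      real_siteToBoundary_antitone (criticalProbI d) h2mn
    have hsuper := RSW3.oneArmProb_mul_le hd0 (criticalProbI d) n 1
    have hπ2m : c₀ / (2 * d) * oneArmProb d (criticalProbI d) n ≤ oneArmProb d (criticalProbI d) (2 * m) := by
      have h1 : oneArmProb d (criticalProbI d) n * c₀ ≤ 2 * (d : ℝ) * oneArmProb d (criticalProbI d) (n + 1) :=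
        (mul_le_mul_of_nonneg_left hπ1 hπn0).trans hsuper
      rw [div_mul_eq_mul_div, div_le_iff₀ (by positivity)]
      nlinarith [hanti, h1]
    -- `P(Λ(n) ↔ ∂ⁱⁿΛ(N)) ≤ P(Λ(2m) ↔ ∂ⁱⁿΛ(N))`
    have hbc : μ.real (boxCrossing d n N) ≤ μ.real (boxCrossing d (2 * m) N) :=
      measureReal_mono (boxCrossing_mono_left hn2m N)
    have hπ2m0 : 0 ≤ oneArmProb d (criticalProbI d) (2 * m) := measureReal_nonneg
    calc min c₄ (ϰ * (c₀ / (2 * d))) * (oneArmProb d (criticalProbI d) n * μ.real (boxCrossing d n N))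
        ≤ ϰ * (c₀ / (2 * d)) * (oneArmProb d (criticalProbI d) n * μ.real (boxCrossing d n N)) :=
          mul_le_mul_of_nonneg_right (min_le_right _ _) (mul_nonneg hπn0 hbc0)
      _ = ϰ * (c₀ / (2 * d) * oneArmProb d (criticalProbI d) n) * μ.real (boxCrossing d n N) := by ring
      _ ≤ ϰ * oneArmProb d (criticalProbI d) (2 * m) * μ.real (boxCrossing d (2 * m) N) :=
          mul_le_mul (mul_le_mul_of_nonneg_left hπ2m hϰ.le) hbc hbc0 (mul_nonneg hϰ.le hπ2m0)
      _ ≤ oneArmProb d (criticalProbI d) N := hstep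
  · -- near scales: `N ≤ 2n+2 ≤ 4n`, so `π(N) ≥ π(4n) ≥ c₄ π(n)`
    have hN4 : N ≤ 4 * n := by omega
    have hanti : oneArmProb d (criticalProbI d) (4 * n) ≤ oneArmProb d (criticalProbI d) N :=
      real_siteToBoundary_antitone (criticalProbI d) hN4
    have h4 := hfour n hn
    calc min c₄ (ϰ * (c₀ / (2 * d))) * (oneArmProb d (criticalProbI d) n * μ.real (boxCrossing d n N))
        ≤ c₄ * (oneArmProb d (criticalProbI d) n * 1) :=
          mul_le_mul (min_le_left _ _) (mul_le_mul_of_nonneg_left hbc1 hπn0) (mul_nonneg hπn0 hbc0) hc₄.le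
      _ = c₄ * oneArmProb d (criticalProbI d) n := by ring
      _ ≤ oneArmProb d (criticalProbI d) N := h4.trans hanti

/-- **At `p_c(ℤ³)`: `SetToSetQuasiMult → ∃ c > 0, OneArmQuasiMultAt 3 p_c c`** — Basu–Sapozhnikov's open input for the
IIC of `ℤ³` (box form) contains the lane's strongest typed (S2) statement, quasi-multiplicativity uniform in the
aspect ratio. [cite: BasuSapozhnikov2017ECP, §1 assumption (A2) and Thm. 1.1] -/
theorem oneArmQuasiMultAt_of_setToSetQuasiMult (h : SetToSetQuasiMult) :
    ∃ c : ℝ, 0 < c ∧ OneArmQuasiMultAt 3 (criticalProbI 3) c := by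
  obtain ⟨ϰ, hϰ, hA2⟩ := h
  exact oneArmQuasiMultAt_of_setToSetQuasiMultAt (d := 3) (by norm_num) hϰ hA2

end Summit.CriticalPhenomena.PercolationContinuityZ3.Theorems.Crossing

end
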